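import Summits.AtomisticToContinuum.Crystallization.Theorems.FrustratedLawDichotomyStrainedPatchHomEntryGram

/-!
# Kit for the reflected (P1) FIT prune on entry boxes: fcc kissing labels, pattern ↔ label dictionary, the half-Gram `⟪U fᵢ, fⱼ⟫` and label
# quadratic forms in the `Numerics.FI` kernel

decomp-a2c hand-2 g22 (crux `AperiodicFrustratedLawGap`, stmt-AtomisticToContinuum-27623; sequel of `…HomEntryGram`).  The (P1) prune
`…HomPruned.pruneFcc_of_centre_good` + `…HomPrunesFit.goodAtScale_centre_of_fit_fcc` needs, uniformly on an entry box: the twelve displacement vectors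
`U q` (`q ∈ fccKissingPattern`) as lattice vectors `latPt U fccVec b`, enclosures of `‖U q‖² = Σ bᵢbⱼ⟪U fᵢ, U fⱼ⟫` and of `⟪U q, q⟫ = Σ bᵢbⱼ⟪U fᵢ, fⱼ⟫`,
and the same for the second-shell labels.  This module supplies the vocabulary:

* §1 `recon b = (b₁+b₂, b₀+b₂, b₀+b₁)` (integer coordinates of `√2 · fccPoint b`), `labOf` (its inverse on `D₃`), the explicit label list `K12`, and the
  dictionary `fccPoint b = (√2)⁻¹ • intVec (recon b)`, `q ∈ fccKissingPattern ↔ q = fccPoint b, b ∈ K12` (both directions, by `decide` on `fccInt`);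
* §2 (`latPt U fccVec b = U (fccPoint b)` is `…HomRelief.latPt_fccVec_eq`) `⟪U (fccPoint b), fccPoint b⟫ = Σᵢⱼ bᵢ bⱼ ⟪U fᵢ, fⱼ⟫`, and the half-Gram identity
  `⟪U fᵢ, fⱼ⟫ = ½ (Σₐ sᵢ(a) − sᵢ(j))`, `sᵢ(a) = Σ_b u_ab − u_ai`;
* §3 kernel side: `hgramFI` (encloses `⟪U fᵢ, fⱼ⟫`), `qformFI T b = Σ bᵢbⱼ T i j` (exact integer scaling of an FI table) with `mem_qformFI`, the two tables
  `gramT / hgramT` of an entry box, ★ `mem_normSq_latPt` / ★ `mem_inner_latPt`, and `lmin` (list minimum) with its two lemmas.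

All definitions computable; 0 sorry; standard axioms; no instances / notation.  `--supports stmt-AtomisticToContinuum-27623`.
-/

namespace Summit.AtomisticToContinuum.Crystallization.Theorems.FrustratedLawDichotomyStrainedPatchHomEntryFitKit

open scoped BigOperators RealInnerProductSpace
open Literature.Analysis.ValidatedNumerics.Numerics
open Literature.Geometry.DiscreteGeometry (fccKissingPattern fccInt intVec scaledPattern)
open Summit.AtomisticToContinuum.Crystallization.Theorems.ChargedEnergyGapNegative (E3)
open Summit.AtomisticToContinuum.Crystallization.Theorems.FrustratedLawDichotomyStrainedPatchHomSplit (latPt)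
open Summit.AtomisticToContinuum.Crystallization.Theorems.FrustratedLawDichotomyStrainedPatchHomCoords (apply_eq_sum_entries)
open Summit.AtomisticToContinuum.Crystallization.Theorems.FrustratedLawDichotomyStrainedPatchHomLeafCalculus (inner_eq_sum_apply)
open Summit.AtomisticToContinuum.Crystallization.Theorems.FrustratedLawDichotomyStrainedPatchHomEntryGram
open Literature.Barriers.AtomisticToContinuum.FlatleyTheil2015 (fccVec fccPoint fccPoint_eq_sum)

/-! ## §1. Labels of the fcc kissing pattern -/

/-- Integer coordinates of `√2 · fccPoint b`: `(b₁ + b₂, b₀ + b₂, b₀ + b₁)`. -/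
def recon (b : Fin 3 → ℤ) : Fin 3 → ℤ := ![b 1 + b 2, b 0 + b 2, b 0 + b 1]

/-- The label of a `D₃` vector `v` (even coordinate sum): the `b` with `recon b = v`. -/
def labOf (v : Fin 3 → ℤ) : Fin 3 → ℤ := ![(v 1 + v 2 - v 0) / 2, (v 0 + v 2 - v 1) / 2, (v 0 + v 1 - v 2) / 2]

/-- The twelve labels of the fcc kissing vectors (`recon '' K12 = fccInt`). -/
def K12 : List (Fin 3 → ℤ) :=
  [![0, 0, 1], ![-1, 1, 0], ![1, -1, 0], ![0, 0, -1], ![0, 1, 0], ![-1, 0, 1], ![1, 0, -1], ![0, -1, 0], ![1, 0, 0], ![0, -1, 1], ![0, 1, -1],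
    ![-1, 0, 0]]

/-- `recon ∘ labOf = id` on `fccInt`. [formal bookkeeping] -/
theorem recon_labOf : ∀ v ∈ fccInt, recon (labOf v) = v := by decide

/-- `labOf` maps `fccInt` into `K12`. [formal bookkeeping] -/
theorem labOf_mem_K12 : ∀ v ∈ fccInt, labOf v ∈ K12 := by decide

/-- `recon` maps `K12` into `fccInt`. [formal bookkeeping] -/
theorem recon_mem_fccInt : ∀ b ∈ K12, recon b ∈ fccInt := by decide

/-- `K12` avoids `0`. [formal bookkeeping] -/
theorem ne_zero_of_mem_K12 : ∀ b ∈ K12, b ≠ 0 := by decide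

/-- ★ Dictionary: `fccPoint b = (√2)⁻¹ • intVec (recon b)`. [folklore] -/
theorem fccPoint_eq_smul_intVec (b : Fin 3 → ℤ) : fccPoint b = (Real.sqrt 2)⁻¹ • intVec (recon b) := by
  ext i
  fin_cases i <;> simp [recon, intVec, div_eq_mul_inv, mul_comm]

/-- The pattern point of `v ∈ fccInt` is `fccPoint (labOf v)`. [folklore] -/
theorem smul_intVec_eq_fccPoint {v : Fin 3 → ℤ} (hv : v ∈ fccInt) : (Real.sqrt (2 : ℕ))⁻¹ • intVec v = fccPoint (labOf v) := by
  rw [fccPoint_eq_smul_intVec, recon_labOf v hv, Nat.cast_ofNat]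

/-- ★ Every pattern point is `fccPoint b` for some `b ∈ K12`. [folklore] -/
theorem exists_label_of_mem_pattern {q : E3} (hq : q ∈ fccKissingPattern) : ∃ b ∈ K12, q = fccPoint b := by
  obtain ⟨v, hv, rfl⟩ := Finset.mem_image.1 hq
  exact ⟨labOf v, labOf_mem_K12 v hv, smul_intVec_eq_fccPoint hv⟩

/-- ★ `fccPoint b ∈ fccKissingPattern` whenever `recon b ∈ fccInt` (in particular for `b ∈ K12`). [folklore] -/
theorem fccPoint_mem_pattern_of_recon {b : Fin 3 → ℤ} (hb : recon b ∈ fccInt) : fccPoint b ∈ fccKissingPattern := by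
  refine Finset.mem_image.2 ⟨recon b, hb, ?_⟩
  rw [fccPoint_eq_smul_intVec, Nat.cast_ofNat]

/-- `fccPoint b ∈ fccKissingPattern` for `b ∈ K12`. [folklore] -/
theorem fccPoint_mem_pattern {b : Fin 3 → ℤ} (hb : b ∈ K12) : fccPoint b ∈ fccKissingPattern :=
  fccPoint_mem_pattern_of_recon (recon_mem_fccInt b hb)

/-! ## §2. Real identities for the lattice vectors `U (fccPoint b)` -/

/-- ★ `⟪U (fccPoint b), fccPoint b⟫ = Σᵢⱼ bᵢ bⱼ ⟪U fᵢ, fⱼ⟫`. [folklore] -/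
theorem inner_apply_fccPoint_eq_sum (U : E3 →L[ℝ] E3) (b : Fin 3 → ℤ) :
    ⟪U (fccPoint b), fccPoint b⟫ = ∑ i : Fin 3, ∑ j : Fin 3, (b i : ℝ) * (b j : ℝ) * ⟪U (fccVec i), fccVec j⟫ := by
  rw [fccPoint_eq_sum, map_sum, sum_inner]
  refine Finset.sum_congr rfl fun i _ => ?_
  rw [map_smul, inner_sum]
  refine Finset.sum_congr rfl fun j _ => ?_
  rw [real_inner_smul_left, real_inner_smul_right]; ring

/-- ★ **Half-Gram datum from entries**: `⟪U fᵢ, fⱼ⟫ = ½ ((Σₐ sᵢ(a)) − sᵢ(j))`, `sᵢ(a) = Σ_b u_ab − u_ai`, `u_ab = (U e_b) a`. [folklore] -/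
theorem inner_map_fccVec_fccVec_eq (U : E3 →L[ℝ] E3) (i j : Fin 3) :
    ⟪U (fccVec i), fccVec j⟫ =
      ((∑ a : Fin 3, ((∑ b : Fin 3, (U (EuclideanSpace.single b (1 : ℝ))) a) - (U (EuclideanSpace.single i (1 : ℝ))) a)) -
        ((∑ b : Fin 3, (U (EuclideanSpace.single b (1 : ℝ))) j) - (U (EuclideanSpace.single i (1 : ℝ))) j)) / 2 := by
  have hc : (Real.sqrt 2)⁻¹ * (Real.sqrt 2)⁻¹ = 1 / 2 := by
    rw [← mul_inv, Real.mul_self_sqrt (by norm_num : (0 : ℝ) ≤ 2)]; norm_num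
  have hrow : ∀ a : Fin 3, (U (fccVec i)) a =
      ((∑ b : Fin 3, (U (EuclideanSpace.single b (1 : ℝ))) a) - (U (EuclideanSpace.single i (1 : ℝ))) a) * (Real.sqrt 2)⁻¹ := fun a => by
    rw [apply_eq_sum_entries, sum_mul_fccVec]
  rw [inner_eq_sum_apply, sum_mul_fccVec (fun a => (U (fccVec i)) a) j]
  simp only [hrow]
  rw [← Finset.sum_mul]
  calc ((∑ a : Fin 3, ((∑ b : Fin 3, (U (EuclideanSpace.single b (1 : ℝ))) a) - (U (EuclideanSpace.single i (1 : ℝ))) a)) * (Real.sqrt 2)⁻¹ -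
        ((∑ b : Fin 3, (U (EuclideanSpace.single b (1 : ℝ))) j) - (U (EuclideanSpace.single i (1 : ℝ))) j) * (Real.sqrt 2)⁻¹) * (Real.sqrt 2)⁻¹
      = ((∑ a : Fin 3, ((∑ b : Fin 3, (U (EuclideanSpace.single b (1 : ℝ))) a) - (U (EuclideanSpace.single i (1 : ℝ))) a)) -
          ((∑ b : Fin 3, (U (EuclideanSpace.single b (1 : ℝ))) j) - (U (EuclideanSpace.single i (1 : ℝ))) j)) *
          ((Real.sqrt 2)⁻¹ * (Real.sqrt 2)⁻¹) := by ring
    _ = _ := by rw [hc]; ring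

/-! ## §3. Kernel side: half-Gram, label quadratic forms, the two tables of an entry box, list minimum -/

/-- The half-Gram entry `⟪U fᵢ, fⱼ⟫` in the kernel: `(Σ_{a ≠ j} offSum i a) / 2` (the outer off-sum reuses `offSumFI` on the table `a ↦ offSum i a`). -/
def hgramFI (E : Fin 3 × Fin 3 → FI) (i j : Fin 3) : FI := (offSumFI (fun p : Fin 3 × Fin 3 => offSumFI E i p.2) j 0).divNat 2

/-- ★ `hgramFI` encloses `⟪U fᵢ, fⱼ⟫` when the entries are enclosed. [formal bookkeeping] -/
theorem mem_hgramFI (U : E3 →L[ℝ] E3) {E : Fin 3 × Fin 3 → FI}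
    (h : ∀ ab : Fin 3 × Fin 3, FI.mem ((U (EuclideanSpace.single ab.2 (1 : ℝ))) ab.1) (E ab)) (i j : Fin 3) :
    FI.mem ⟪U (fccVec i), fccVec j⟫ (hgramFI E i j) := by
  rw [inner_map_fccVec_fccVec_eq]
  -- inner off-sums `s_i(a)`
  have hS : ∀ p : Fin 3 × Fin 3, FI.mem ((fun p : Fin 3 × Fin 3 =>
      (∑ b : Fin 3, (U (EuclideanSpace.single b (1 : ℝ))) p.2) - (U (EuclideanSpace.single i (1 : ℝ))) p.2) p)
      ((fun p : Fin 3 × Fin 3 => offSumFI E i p.2) p) := fun p =>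
    mem_offSumFI (u := fun ab : Fin 3 × Fin 3 => (U (EuclideanSpace.single ab.2 (1 : ℝ))) ab.1) h i p.2
  -- outer off-sum over `a ≠ j`
  have hO := mem_offSumFI (u := fun p : Fin 3 × Fin 3 =>
      (∑ b : Fin 3, (U (EuclideanSpace.single b (1 : ℝ))) p.2) - (U (EuclideanSpace.single i (1 : ℝ))) p.2)
    (E := fun p : Fin 3 × Fin 3 => offSumFI E i p.2) hS j 0
  have h2 := FI.mem_divNat (n := 2) hO (by norm_num)
  simp only [Nat.cast_ofNat] at h2
  exact h2

/-- Quadratic form of the label `b` over an FI table: `Σᵢⱼ bᵢ bⱼ · T i j` (integer scalings are exact). -/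
def qformFI (T : Fin 3 → Fin 3 → FI) (b : Fin 3 → ℤ) : FI :=
  (((((T 0 0).mulInt (b 0 * b 0)).add ((T 0 1).mulInt (b 0 * b 1))).add ((T 0 2).mulInt (b 0 * b 2))).add
    ((((T 1 0).mulInt (b 1 * b 0)).add ((T 1 1).mulInt (b 1 * b 1))).add ((T 1 2).mulInt (b 1 * b 2)))).add
    ((((T 2 0).mulInt (b 2 * b 0)).add ((T 2 1).mulInt (b 2 * b 1))).add ((T 2 2).mulInt (b 2 * b 2)))

/-- ★ `qformFI` encloses `Σᵢⱼ bᵢ bⱼ tᵢⱼ` when `T` encloses `t`. [formal bookkeeping] -/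
theorem mem_qformFI {T : Fin 3 → Fin 3 → FI} {t : Fin 3 → Fin 3 → ℝ} (h : ∀ i j, FI.mem (t i j) (T i j)) (b : Fin 3 → ℤ) :
    FI.mem (∑ i : Fin 3, ∑ j : Fin 3, (b i : ℝ) * (b j : ℝ) * t i j) (qformFI T b) := by
  have e : ∀ i j : Fin 3, (b i : ℝ) * (b j : ℝ) * t i j = t i j * ((b i * b j : ℤ) : ℝ) := fun i j => by push_cast; ring
  simp only [Fin.sum_univ_three, e, qformFI]
  have m := fun i j => FI.mem_mulInt (h i j) (b i * b j)
  exact FI.mem_add (FI.mem_add (FI.mem_add (FI.mem_add (m 0 0) (m 0 1)) (m 0 2)) (FI.mem_add (FI.mem_add (m 1 0) (m 1 1)) (m 1 2)))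
    (FI.mem_add (FI.mem_add (m 2 0) (m 2 1)) (m 2 2))

/-- The Gram table of the entry box `(c, w)` in the kernel. -/
def gramT (c w : Fin 3 × Fin 3 → ℤ) : Fin 3 → Fin 3 → FI := fun i j => gramFI (entryFI c w) i j

/-- The half-Gram table of the entry box `(c, w)` in the kernel. -/
def hgramT (c w : Fin 3 × Fin 3 → ℤ) : Fin 3 → Fin 3 → FI := fun i j => hgramFI (entryFI c w) i j

/-- ★ **`‖latPt U fccVec b‖² ∈ qformFI (gramT c w) b`** on the entry box. [folklore] -/
theorem mem_normSq_latPt (U : E3 →L[ℝ] E3) {c w : Fin 3 × Fin 3 → ℤ}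
    (hbox : ∀ ab : Fin 3 × Fin 3, |(U (EuclideanSpace.single ab.2 (1 : ℝ))) ab.1 - (c ab : ℝ) / SC| ≤ (w ab : ℝ) / SC) (b : Fin 3 → ℤ) :
    FI.mem (‖latPt U fccVec b‖ ^ 2) (qformFI (gramT c w) b) := by
  rw [FrustratedLawDichotomyStrainedPatchHomGram.norm_sq_latPt_eq_sum_gram]
  exact mem_qformFI (fun i j => mem_gramFI U (fun ab => mem_entryFI (hbox ab)) i j) b

/-- ★ **`⟪U (fccPoint b), fccPoint b⟫ ∈ qformFI (hgramT c w) b`** on the entry box. [folklore] -/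
theorem mem_inner_latPt (U : E3 →L[ℝ] E3) {c w : Fin 3 × Fin 3 → ℤ}
    (hbox : ∀ ab : Fin 3 × Fin 3, |(U (EuclideanSpace.single ab.2 (1 : ℝ))) ab.1 - (c ab : ℝ) / SC| ≤ (w ab : ℝ) / SC) (b : Fin 3 → ℤ) :
    FI.mem ⟪U (fccPoint b), fccPoint b⟫ (qformFI (hgramT c w) b) := by
  rw [inner_apply_fccPoint_eq_sum]
  exact mem_qformFI (fun i j => mem_hgramFI U (fun ab => mem_entryFI (hbox ab)) i j) b

/-- Minimum of a list of integers (`0` on the empty list). -/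
def lmin : List ℤ → ℤ
  | [] => 0
  | [x] => x
  | x :: y :: l => min x (lmin (y :: l))

/-- `lmin l ≤ x` for every `x ∈ l`. [formal bookkeeping] -/
theorem lmin_le_of_mem : ∀ (l : List ℤ) (x : ℤ), x ∈ l → lmin l ≤ x
  | [], x, hx => by simp at hx
  | [y], x, hx => by simp at hx; subst hx; simp [lmin]
  | y :: z :: l, x, hx => by
    rw [lmin]
    rcases List.mem_cons.1 hx with rfl | hx
    · exact min_le_left _ _
    · exact (min_le_right _ _).trans (lmin_le_of_mem (z :: l) x hx)

/-- `lmin l ∈ l` for a nonempty list. [formal bookkeeping] -/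
theorem lmin_mem : ∀ (l : List ℤ), l ≠ [] → lmin l ∈ l
  | [], h => (h rfl).elim
  | [y], _ => by simp [lmin]
  | y :: z :: l, _ => by
    rw [lmin]
    rcases min_choice y (lmin (z :: l)) with h | h
    · rw [h]; exact List.mem_cons_self
    · rw [h]; exact List.mem_cons_of_mem _ (lmin_mem (z :: l) (List.cons_ne_nil _ _))

/-! ## §4. Kernel smoke test -/

/-- At the thin identity box: `‖f₂‖² = 1` exactly (`K12` head label `(0,0,1)`), `⟪f₂, f₂⟫ = 1`; `lmin`. -/
example : qformFI (gramT rootC (fun _ => 0)) ![0, 0, 1] = ⟨(SC : ℤ), (SC : ℤ)⟩ ∧ qformFI (hgramT rootC (fun _ => 0)) ![0, 0, 1] = ⟨(SC : ℤ), (SC : ℤ)⟩ ∧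
    qformFI (gramT rootC (fun _ => 0)) ![1, 1, 0] = ⟨3 * (SC : ℤ), 3 * (SC : ℤ)⟩ ∧ lmin [5, 3, 9] = 3 := by
  decide +kernel

end Summit.AtomisticToContinuum.Crystallization.Theorems.FrustratedLawDichotomyStrainedPatchHomEntryFitKit
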